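import Summits.QuantumAdvantage.QuantumAdvantage.Theorems.CubicForrelationNearExactIsExactCubicFormCellL2
import Summits.QuantumAdvantage.QuantumAdvantage.Theorems.CubicForrelationNearExactIsExactCubicFormSymplectic
import Summits.QuantumAdvantage.QuantumAdvantage.Theorems.CubicForrelationNearExactIsExactCubicFormDicksonExact
import Summits.QuantumAdvantage.QuantumAdvantage.Theorems.CubicForrelationNearExactIsExactCubicFormRank
import Summits.QuantumAdvantage.QuantumAdvantage.Theorems.CubicForrelationNearExactIsExactCubicFormHalvesRankTwo
import Summits.QuantumAdvantage.QuantumAdvantage.Theorems.CubicForrelationNearExactIsExactCubicFormCellsOne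
import Summits.QuantumAdvantage.QuantumAdvantage.Theorems.CubicForrelationNearExactIsExactCubicFormBalanced

/-!
# Crux `CubicForrelation.NearExactIsExact` (stmt-QuantumAdvantage-14043) — E1280-even, R4 branch, descendant `T` (`HL 1`): a cell with
  cubic form `s₀s₁s₂` whose quadratic part touches the free block weighs `≥ 40`

Certificate seat `b2b-cforr-cert` (gen 43).  HONEST FRAMING: kernel-checked cell lemma (standard axioms) for the descendant `t̄₇ = T`
of …CubicFormR4PartnerDispatch (`HL 1`); it replaces the fibre/Arf analysis of E1280-HANDPROOFS §2.2 (types of the menu (MT)) by a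
rank argument on the two `s₀`-halves.  Let `f : 𝔽₂^{1+6} → 𝔽₂` have third differences `u₀·ω(v,w) ⊕ v₀·ω(u,w) ⊕ w₀·ω(u,v)` with
`ω = s_{lo} ∧ s_{hi}` (the cubic form of `s₀ s_{1+lo} s_{1+hi}`), and suppose the second difference of `f` at `0` along two unit
vectors `e_{1+m}, e_{1+m'}` OFF `{0, 1+lo, 1+hi}` is `1`.  Then `#f ≥ 40` (`tq1_cell_forty`).
Proof: the halves `g_b = f(b,·)` are quadratics whose forms `B₀, B₁` differ by `ω` (…CubicFormCellL2) and agree at `(e_m, e_{m'})`,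
where they are `1`; so each has rank `≥ 2` and weight `≥ 16` (Dickson, …CubicFormDicksonExact with a maximal frame from
…CubicFormSymplectic); if one has rank `≥ 4` it weighs `≥ 24` and `#f = #g₀ + #g₁ ≥ 40`; if both have rank `2` they are product forms
`λ_b ∧ μ_b` (…CubicFormHalvesRankTwo), and `λ₁∧μ₁ = λ₀∧μ₀ ⊕ e_{lo}∧e_{hi}` restricted to the four vectors `e_m, e_{m'}, e_{lo}, e_{hi}`
is impossible (`tq1_r4x`, a 16-bit `decide`: the right side has rank `4` there).  `tq1_half_rank` is the single-half statement.
Nothing about `θ₁₂`; NOT summit progress.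

References: this seat lineage (g39 HANDPROOFS §2.2, App. A; g43 LEAN-GEN43); L. E. Dickson (1901); MacWilliams–Sloane Ch. 15 §2.
Axioms: the standard three.
-/

set_option linter.dupNamespace false -- D-0017: single-problem summit ⇒ `QuantumAdvantage.QuantumAdvantage` by design

namespace Summit.QuantumAdvantage.QuantumAdvantage.Theorems.CubicForrelation.NearExactIsExact

open Finset
open Literature.Computability.QuantumComplexity
open Literature.Computability.QuantumComplexity.BuzetChailloux (bxor zeroVec bxor_comm bxor_self bxor_zeroVec zeroVec_bxor
  bxor_bxor_cancel_left)

/-- **Two product forms cannot differ by a hyperbolic plane transverse to a pair where they are `1`.**  With `B(x,y) = l_x m_y ⊕ m_x l_y`,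
`B'(x,y) = l'_x m'_y ⊕ m'_x l'_y` on four vectors `x₁..x₄`: `B(x₁,x₂) = 1`, `B' = B` on all pairs except `B'(x₃,x₄) = B(x₃,x₄) ⊕ 1` is
impossible (the form `B ⊕ x₃∧x₄` has rank `4` on these vectors). `decide`. [this work] -/
theorem tq1_r4x : ∀ (l1 l2 l3 l4 m1 m2 m3 m4 l1' l2' l3' l4' m1' m2' m3' m4' : Bool),
    ((l1 && m2) ^^ (m1 && l2)) = true →
    ((l1' && m2') ^^ (m1' && l2')) = ((l1 && m2) ^^ (m1 && l2)) →
    ((l1' && m3') ^^ (m1' && l3')) = ((l1 && m3) ^^ (m1 && l3)) →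
    ((l1' && m4') ^^ (m1' && l4')) = ((l1 && m4) ^^ (m1 && l4)) →
    ((l2' && m3') ^^ (m2' && l3')) = ((l2 && m3) ^^ (m2 && l3)) →
    ((l2' && m4') ^^ (m2' && l4')) = ((l2 && m4) ^^ (m2 && l4)) →
    ((l3' && m4') ^^ (m3' && l4')) = !((l3 && m4) ^^ (m3 && l4)) → False := by
  decide

/-- **One half: rank `≥ 2` gives `≥ 16` ones; fewer than `24` ones forces a product form.**  Let `g : 𝔽₂⁶ → 𝔽₂` have vanishing third
differences and let its (base-point free) form `B` satisfy `B(x, x') = 1` for some `x, x'`.  Then `#g ≥ 16`, and if `#g < 24` then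
`B(y,y') = B(y,c)B(y',b) ⊕ B(y,b)B(y',c)` for some `b, c` (a maximal frame of size `1`). [this work; cite: MacWilliamsSloane1977, Ch. 15 §2] -/
theorem tq1_half_rank (g : (Fin 6 → Bool) → Bool)
    (h3 : ∀ u v w x : Fin 6 → Bool, (((g x ^^ g (bxor x w)) ^^ (g (bxor x v) ^^ g (bxor (bxor x v) w))) ^^
        ((g (bxor x u) ^^ g (bxor (bxor x u) w)) ^^ (g (bxor (bxor x u) v) ^^ g (bxor (bxor (bxor x u) v) w)))) = false)
    (x x' : Fin 6 → Bool) (hx : ((g zeroVec ^^ g (bxor zeroVec x')) ^^ (g (bxor zeroVec x) ^^ g (bxor (bxor zeroVec x) x'))) = true) :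
    16 ≤ #(univ.filter fun s : Fin 6 → Bool => g s = true) ∧
    (#(univ.filter fun s : Fin 6 → Bool => g s = true) < 24 → ∃ b c : Fin 6 → Bool, ∀ y y' : Fin 6 → Bool,
      ((g zeroVec ^^ g (bxor zeroVec y')) ^^ (g (bxor zeroVec y) ^^ g (bxor (bxor zeroVec y) y'))) =
        ((((g zeroVec ^^ g (bxor zeroVec c)) ^^ (g (bxor zeroVec y) ^^ g (bxor (bxor zeroVec y) c))) &&
            ((g zeroVec ^^ g (bxor zeroVec b)) ^^ (g (bxor zeroVec y') ^^ g (bxor (bxor zeroVec y') b)))) ^^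
          (((g zeroVec ^^ g (bxor zeroVec b)) ^^ (g (bxor zeroVec y) ^^ g (bxor (bxor zeroVec y) b))) &&
            ((g zeroVec ^^ g (bxor zeroVec c)) ^^ (g (bxor zeroVec y') ^^ g (bxor (bxor zeroVec y') c)))))) := by
  classical
  -- the base-point free form
  set B : (Fin 6 → Bool) → (Fin 6 → Bool) → Bool :=
    fun v w => (g zeroVec ^^ g (bxor zeroVec w)) ^^ (g (bxor zeroVec v) ^^ g (bxor (bxor zeroVec v) w)) with hBdef
  have hB' : ∀ v w y, ((g y ^^ g (bxor y w)) ^^ (g (bxor y v) ^^ g (bxor (bxor y v) w))) = B v w :=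
    fun v w y => tl2_second_const g h3 v w y
  obtain ⟨hsymm, hadd, halt, -⟩ := tcb_form_basic g B hB'
  have hxB : B x x' = true := hx
  -- a maximal frame and Dickson's theorem
  obtain ⟨h, b, c, hbc, hbc', hbb, hcc, hmax⟩ := tcs_frame_exists B hsymm halt
  obtain ⟨hle, htri⟩ := tce_dickson_exact g B hB' h b c hbc hbc' hbb hmax
  -- `h ≥ 1`
  have hpos : 1 ≤ h := by
    rcases Nat.eq_zero_or_pos h with h0 | hpos
    · subst h0
      have := tce_form_zero_of_frame_zero B b c hmax x x'
      rw [hxB] at this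
      exact absurd this (by decide)
    · exact hpos
  have hpow : 2 ^ (6 - h) ≤ 32 := by
    calc 2 ^ (6 - h) ≤ 2 ^ 5 := Nat.pow_le_pow_right (by norm_num) (by omega)
      _ = 32 := by norm_num
  refine ⟨?_, fun hlt => ?_⟩
  · generalize hX : 2 ^ (6 - h) = X at htri hpow
    omega
  · -- `h = 1`
    have hh1 : h = 1 := by
      by_contra hne
      have hpow' : 2 ^ (6 - h) ≤ 16 := by
        calc 2 ^ (6 - h) ≤ 2 ^ 4 := Nat.pow_le_pow_right (by norm_num) (by omega)
          _ = 16 := by norm_num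
      generalize hX : 2 ^ (6 - h) = X at htri hpow'
      omega
    subst hh1
    exact ⟨b 0, c 0, fun y y' => tcl_rank_one_product B hsymm hadd b c hbc hbc' hbb hcc hmax y y'⟩

/-- **Cell lemma for descendant `T`: a cell whose quadratic part touches the free block weighs `≥ 40`.**  See the module docstring.
[this work; cite: MacWilliamsSloane1977, Ch. 15 §2] -/
theorem tq1_cell_forty (f : (Fin (1 + 6) → Bool) → Bool) (lo hi : Fin 1 → Fin 6) (hlohi : lo 0 ≠ hi 0)
    (ω' : (Fin 6 → Bool) → (Fin 6 → Bool) → Bool)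
    (hω' : ∀ v w, ω' v w = decide ((∑ i : Fin 1, ((if v (lo i) = true then (1 : ZMod 2) else 0) * (if w (hi i) = true then (1 : ZMod 2) else 0) +
        (if v (hi i) = true then (1 : ZMod 2) else 0) * (if w (lo i) = true then (1 : ZMod 2) else 0))) = 1))
    (hT : ∀ u v w x : Fin (1 + 6) → Bool,
      (((f x ^^ f (bxor x w)) ^^ (f (bxor x v) ^^ f (bxor (bxor x v) w))) ^^
          ((f (bxor x u) ^^ f (bxor (bxor x u) w)) ^^ (f (bxor (bxor x u) v) ^^ f (bxor (bxor (bxor x u) v) w)))) =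
        (((u (Fin.castAdd 6 (0 : Fin 1)) && ω' (fun j => v (Fin.natAdd 1 j)) (fun j => w (Fin.natAdd 1 j))) ^^
            (v (Fin.castAdd 6 (0 : Fin 1)) && ω' (fun j => u (Fin.natAdd 1 j)) (fun j => w (Fin.natAdd 1 j)))) ^^
          (w (Fin.castAdd 6 (0 : Fin 1)) && ω' (fun j => u (Fin.natAdd 1 j)) (fun j => v (Fin.natAdd 1 j)))))
    (m m' : Fin 6) (hml : m ≠ lo 0) (hmh : m ≠ hi 0) (hm'l : m' ≠ lo 0) (hm'h : m' ≠ hi 0)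
    (hΞ : ((f zeroVec ^^ f (fun l => decide (l = Fin.natAdd 1 m'))) ^^
        (f (fun l => decide (l = Fin.natAdd 1 m)) ^^
          f (bxor (fun l => decide (l = Fin.natAdd 1 m)) (fun l => decide (l = Fin.natAdd 1 m'))))) = true) :
    40 ≤ #(univ.filter fun y : Fin (1 + 6) → Bool => f y = true) := by
  obtain ⟨h3, hforms⟩ := tl2_cell_halves f ω' hT
  have hcard := tco_card_halves f
  -- `ω'` in closed form
  have hωf : ∀ v w : Fin 6 → Bool, ω' v w = ((v (lo 0) && w (hi 0)) ^^ (v (hi 0) && w (lo 0))) := by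
    intro v w
    rw [hω', Fin.sum_univ_one]
    cases v (lo 0) <;> cases w (hi 0) <;> cases v (hi 0) <;> cases w (lo 0) <;> decide
  -- embedded vectors
  have h0 : (zeroVec : Fin (1 + 6) → Bool) = Fin.append ![false] (zeroVec : Fin 6 → Bool) := by
    funext l
    refine Fin.addCases (fun i => ?_) (fun j => ?_) l
    · rw [Fin.append_left]; have : i = 0 := Fin.eq_zero i; subst this; rfl
    · rw [Fin.append_right]; rfl
  have hz1 : (zeroVec : Fin 1 → Bool) = ![false] := by funext i; have : i = 0 := Fin.eq_zero i; subst this; rfl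
  have hunit : ∀ σ : Fin 6, (fun l : Fin (1 + 6) => decide (l = Fin.natAdd 1 σ)) = Fin.append ![false] (fun l : Fin 6 => decide (l = σ)) := by
    intro σ; rw [tco_unit_right, hz1]
  have hff : bxor ![false] ![false] = (![false] : Fin 1 → Bool) := by funext i; have : i = 0 := Fin.eq_zero i; subst this; rfl
  -- the form of the `false`-half at `(e_m, e_{m'})` is `1`
  have hx0 : (((fun s : Fin 6 → Bool => f (Fin.append ![false] s)) zeroVec ^^
        (fun s : Fin 6 → Bool => f (Fin.append ![false] s)) (bxor zeroVec (fun l => decide (l = m')))) ^^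
      ((fun s : Fin 6 → Bool => f (Fin.append ![false] s)) (bxor zeroVec (fun l => decide (l = m))) ^^
        (fun s : Fin 6 → Bool => f (Fin.append ![false] s)) (bxor (bxor zeroVec (fun l => decide (l = m))) (fun l => decide (l = m'))))) = true := by
    simp only [zeroVec_bxor]
    rw [h0, hunit, hunit, tco_append_bxor, hff] at hΞ
    exact hΞ
  -- … and so is the form of the `true`-half (`ω'(e_m, e_{m'}) = 0`)
  have hωmm : ω' (fun l => decide (l = m)) (fun l => decide (l = m')) = false := by
    rw [hωf]
    simp only [decide_eq_false (Ne.symm hml), decide_eq_false (Ne.symm hmh), Bool.false_and, Bool.xor_false]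
  have hx1 : (((fun s : Fin 6 → Bool => f (Fin.append ![true] s)) zeroVec ^^
        (fun s : Fin 6 → Bool => f (Fin.append ![true] s)) (bxor zeroVec (fun l => decide (l = m')))) ^^
      ((fun s : Fin 6 → Bool => f (Fin.append ![true] s)) (bxor zeroVec (fun l => decide (l = m))) ^^
        (fun s : Fin 6 → Bool => f (Fin.append ![true] s)) (bxor (bxor zeroVec (fun l => decide (l = m))) (fun l => decide (l = m'))))) = true := by
    have e := hforms (fun l => decide (l = m)) (fun l => decide (l = m')) zeroVec zeroVec
    rw [hωmm] at e
    simp only at e hx0 ⊢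
    revert e hx0
    generalize f (Fin.append ![true] zeroVec) = a1
    generalize f (Fin.append ![true] (bxor zeroVec fun l => decide (l = m'))) = a2
    generalize f (Fin.append ![true] (bxor zeroVec fun l => decide (l = m))) = a3
    generalize f (Fin.append ![true] (bxor (bxor zeroVec fun l => decide (l = m)) fun l => decide (l = m'))) = a4
    generalize f (Fin.append ![false] zeroVec) = b1
    generalize f (Fin.append ![false] (bxor zeroVec fun l => decide (l = m'))) = b2
    generalize f (Fin.append ![false] (bxor zeroVec fun l => decide (l = m))) = b3
    generalize f (Fin.append ![false] (bxor (bxor zeroVec fun l => decide (l = m)) fun l => decide (l = m'))) = b4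
    cases a1 <;> cases a2 <;> cases a3 <;> cases a4 <;> cases b1 <;> cases b2 <;> cases b3 <;> cases b4 <;> decide
  -- the two halves
  have h30 := h3 false
  have h31 := h3 true
  simp only at h30 h31
  obtain ⟨h16₀, hprod₀⟩ := tq1_half_rank (fun s => f (Fin.append ![false] s)) h30 _ _ hx0
  obtain ⟨h16₁, hprod₁⟩ := tq1_half_rank (fun s => f (Fin.append ![true] s)) h31 _ _ hx1
  by_contra hlt
  rw [not_le, hcard] at hlt
  have hlt₀ : #(univ.filter fun s : Fin 6 → Bool => f (Fin.append ![false] s) = true) < 24 := by omega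
  have hlt₁ : #(univ.filter fun s : Fin 6 → Bool => f (Fin.append ![true] s) = true) < 24 := by omega
  obtain ⟨b₀, c₀, hP₀⟩ := hprod₀ hlt₀
  obtain ⟨b₁, c₁, hP₁⟩ := hprod₁ hlt₁
  -- the four test vectors `e_m, e_{m'}, e_lo, e_hi` and the six relations `B₁ = B₀ ⊕ ω'`
  have rel : ∀ y y' : Fin 6 → Bool,
      (((fun s : Fin 6 → Bool => f (Fin.append ![true] s)) zeroVec ^^ (fun s : Fin 6 → Bool => f (Fin.append ![true] s)) (bxor zeroVec y')) ^^
        ((fun s : Fin 6 → Bool => f (Fin.append ![true] s)) (bxor zeroVec y) ^^ (fun s : Fin 6 → Bool => f (Fin.append ![true] s)) (bxor (bxor zeroVec y) y'))) =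
      ((((fun s : Fin 6 → Bool => f (Fin.append ![false] s)) zeroVec ^^ (fun s : Fin 6 → Bool => f (Fin.append ![false] s)) (bxor zeroVec y')) ^^
        ((fun s : Fin 6 → Bool => f (Fin.append ![false] s)) (bxor zeroVec y) ^^ (fun s : Fin 6 → Bool => f (Fin.append ![false] s)) (bxor (bxor zeroVec y) y'))) ^^
        ω' y y') := by
    intro y y'
    have e := hforms y y' zeroVec zeroVec
    simp only at e ⊢
    revert e
    generalize f (Fin.append ![true] zeroVec) = a1
    generalize f (Fin.append ![true] (bxor zeroVec y')) = a2
    generalize f (Fin.append ![true] (bxor zeroVec y)) = a3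
    generalize f (Fin.append ![true] (bxor (bxor zeroVec y) y')) = a4
    generalize f (Fin.append ![false] zeroVec) = b1
    generalize f (Fin.append ![false] (bxor zeroVec y')) = b2
    generalize f (Fin.append ![false] (bxor zeroVec y)) = b3
    generalize f (Fin.append ![false] (bxor (bxor zeroVec y) y')) = b4
    cases a1 <;> cases a2 <;> cases a3 <;> cases a4 <;> cases b1 <;> cases b2 <;> cases b3 <;> cases b4 <;> cases ω' y y' <;> decide
  -- `ω'` on the test vectors
  have hω12 := hωmm
  have hω13 : ω' (fun l => decide (l = m)) (fun l => decide (l = lo 0)) = false := by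
    rw [hωf]; simp only [decide_eq_false (Ne.symm hml), decide_eq_false (Ne.symm hmh), Bool.false_and, Bool.xor_false]
  have hω14 : ω' (fun l => decide (l = m)) (fun l => decide (l = hi 0)) = false := by
    rw [hωf]; simp only [decide_eq_false (Ne.symm hml), decide_eq_false (Ne.symm hmh), Bool.false_and, Bool.xor_false]
  have hω23 : ω' (fun l => decide (l = m')) (fun l => decide (l = lo 0)) = false := by
    rw [hωf]; simp only [decide_eq_false (Ne.symm hm'l), decide_eq_false (Ne.symm hm'h), Bool.false_and, Bool.xor_false]
  have hω24 : ω' (fun l => decide (l = m')) (fun l => decide (l = hi 0)) = false := by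
    rw [hωf]; simp only [decide_eq_false (Ne.symm hm'l), decide_eq_false (Ne.symm hm'h), Bool.false_and, Bool.xor_false]
  have hω34 : ω' (fun l => decide (l = lo 0)) (fun l => decide (l = hi 0)) = true := by
    rw [hωf]; simp only [decide_true, decide_eq_false hlohi, decide_eq_false (Ne.symm hlohi), Bool.true_and, Bool.and_false,
      Bool.xor_false]
  have r12 := rel (fun l => decide (l = m)) (fun l => decide (l = m'))
  have r13 := rel (fun l => decide (l = m)) (fun l => decide (l = lo 0))
  have r14 := rel (fun l => decide (l = m)) (fun l => decide (l = hi 0))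
  have r23 := rel (fun l => decide (l = m')) (fun l => decide (l = lo 0))
  have r24 := rel (fun l => decide (l = m')) (fun l => decide (l = hi 0))
  have r34 := rel (fun l => decide (l = lo 0)) (fun l => decide (l = hi 0))
  rw [hω12, Bool.xor_false] at r12
  rw [hω13, Bool.xor_false] at r13
  rw [hω14, Bool.xor_false] at r14
  rw [hω23, Bool.xor_false] at r23
  rw [hω24, Bool.xor_false] at r24
  rw [hω34, Bool.xor_true] at r34
  rw [hP₀, hP₁] at r12 r13 r14 r23 r24 r34
  rw [hP₀] at hx0
  exact tq1_r4x _ _ _ _ _ _ _ _ _ _ _ _ _ _ _ _ hx0 r12 r13 r14 r23 r24 r34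

end Summit.QuantumAdvantage.QuantumAdvantage.Theorems.CubicForrelation.NearExactIsExact
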